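import Summits.FinalStateConjecture.FinalStateConjecture.Theorems.NecksCertify.Negative.NoParkingResonance

/-!
# `NecksCertify` (crux stmt-FinalStateConjecture-13549, route StarvedNecks) — negative side:
# the Bargmann threshold of the picked line's rung M2 (`NoParkingDecay`) cannot be relaxed to `2 log 2`

Refuter seat `refuter-cdisprove-stmt-FinalStateConjecture-13549-g2-0` (cdisprove, generation 2),
2026-08-16; workfile `Cruxes/NecksCertify/Disproof.lean` (§T "Targets").  Sorry-free, axioms
`propext`, `Classical.choice`, `Quot.sound`.  Pure real analysis (Mathlib + the toolkit
`NoParkingResonance.lean`).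

The picked line `Cruxes/NecksCertify/Lines/bargmann-small-late-exterior.lean` (lead
`prover-line-stmt-FinalStateConjecture-13549-r-0`) registers the model rung M2 `stub_noParkingDecay`
= `TonelliBargmann → CharacteristicCalculus → NoParkingDecay`: on the late exterior
`Ω = {T ≤ t} × {R₀ ≤ r}` of a cylinder, a bounded `C²` solution `ψ` of `ψ_tt − ψ_rr + V(t,r)ψ = 0`
with `|V| ≤ ν(r)` and BARGMANN NORM `∫_{R₀}^∞ (s − R₀)ν(s) ds ≤ η < 1` inherits the rate-free decay
of the free field `χ` (same slab data, same cylinder trace) in the late retarded region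
`{t − r ≥ u₀ → ∞}` ("no parking").  This file records, kernel-checked:

* `NoParkingDecayBelow η₁` — the rung's statement with its threshold as a parameter;
  `NoParkingDecayBelow 1` is the line file's `NoParkingDecay` VERBATIM (`noParkingDecayBelow_one_iff`,
  by `Iff.rfl`; the line file has `sorry`s and is not importable by a Theorems file, and a closed
  `def … : Prop` copy would be a named fact of the literature, which a stub statement is not);
* `NoParkingDecayUpTo η₀` — the same statement with the threshold `η < 1` replaced by `η ≤ η₀`
  (a one-token weakening of a hypothesis, i.e. a natural strengthening of the rung), and
  `noParkingDecayBelow_one_of_noParkingDecayUpTo : 1 ≤ η₀ → NoParkingDecayUpTo η₀ → NoParkingDecayBelow 1`;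
* `not_noParkingDecayUpTo_two_mul_log_two : ¬ NoParkingDecayUpTo (2 * Real.log 2)` — the
  strengthening is FALSE already at `η₀ = 2 log 2 ≈ 1.386`.  Witness ("a parked zero-energy
  resonance"): `R₀ = T = 0`, the Pöschl–Teller well `V(t,r) = −2 sech² r` (Bargmann norm
  `∫₀^∞ 2s sech² s ds = 2 log 2`), its zero-energy Dirichlet resonance `ψ(t,r) = tanh r` (static,
  bounded by `1`, vanishing on the cylinder, NOT decaying: `ψ(t,2) = tanh 2 > 1/2` at every
  retarded time), and the free field with the same data and trace
  `χ(t,r) = (tanh(r+t) + tanh(r−t))/2 = (tanh(t+r) − tanh(t−r))/2 → 0` uniformly on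
  `{t − r ≥ u₀}` as `u₀ → ∞`.  All fourteen hypotheses of the rung are verified for this instance.

Reading for provers (Disproof.lean §T): any proof of M2 must use `η < 1` quantitatively (the
intended proof does: `lim N ≤ η · lim N`); mode-by-mode use of M2 for Regge–Wheeler couplings with
`η_ℓ = 2M(ℓ(ℓ+1)+3)/R₀ ≥ 1` (i.e. `ℓ ≥ 7` at `R₀ = 100M`, TRIAGE-r1-1 sharpen (2)) meets a genuine
obstruction of this shape (an attractive well of Bargmann norm `> 1` can park a static resonance in
the neck).  Whether the threshold is exactly `1` is left open here (the corner profile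
`min(r − R₀, K)` has Bargmann norm exactly `1` with a δ-well, so no continuous `ν` realises
`η = 1`).  Nothing in this file bears on the TRUTH of M2 as registered (`η < 1`), which this seat
checked on paper (Disproof.lean §T) and believes.
-/

noncomputable section

open Real Set Filter MeasureTheory Topology

namespace Summit.FinalStateConjecture.FinalStateConjecture.Theorems.NecksCertify.Negative

open PoschlTeller

/-! ## §0 The rung and its strengthening -/

/-- **`NoParkingDecayBelow η₁`** — the picked line's model rung M2 with its Bargmann threshold as a
parameter: `NoParkingDecayBelow 1` is, token for token, the def `NoParkingDecay` of
`Cruxes/NecksCertify/Lines/bargmann-small-late-exterior.lean` (registered stub `stub_noParkingDecay`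
= `TonelliBargmann → CharacteristicCalculus → NoParkingDecay`; see `noParkingDecayBelow_one_iff`,
proved by `Iff.rfl`): rate-free no-parking in the late retarded region for `ψ_tt − ψ_rr + Vψ = 0`
on `{T ≤ t, R₀ ≤ r}` under the Bargmann smallness `∫ (s − R₀)ν ≤ η < η₁`.  (Stated as a
ONE-PARAMETER family, not as a closed `Prop`, so that it is a predicate of this file and not a
named fact of the literature; the line file itself has `sorry`s and is not importable here.)
[topic: Summits/FinalStateConjecture/FinalStateConjecture — crux NecksCertify, line bargmann-small-late-exterior, rung M2] -/
def NoParkingDecayBelow (η₁ : ℝ) : Prop :=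
  ∀ (T R₀ η P : ℝ) (ν : ℝ → ℝ) (V ψ χ : ℝ → ℝ → ℝ),
    0 ≤ R₀ → η < η₁ →
    ContinuousOn ν (Set.Ici R₀) →
    IntegrableOn (fun s ↦ (s - R₀) * ν s) (Set.Ioi R₀) →
    (∫ s in Set.Ioi R₀, (s - R₀) * ν s) ≤ η →
    (∀ t r, T ≤ t → R₀ ≤ r → |V t r| ≤ ν r) →
    ContDiff ℝ 2 (Function.uncurry ψ) → ContDiff ℝ 2 (Function.uncurry χ) →
    (∀ t r, T ≤ t → R₀ ≤ r →
      iteratedDeriv 2 (fun s ↦ ψ s r) t - iteratedDeriv 2 (ψ t) r + V t r * ψ t r = 0) →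
    (∀ t r, T ≤ t → R₀ ≤ r → iteratedDeriv 2 (fun s ↦ χ s r) t - iteratedDeriv 2 (χ t) r = 0) →
    (∀ r, R₀ ≤ r → χ T r = ψ T r ∧ deriv (fun s ↦ χ s r) T = deriv (fun s ↦ ψ s r) T) →
    (∀ t, T ≤ t → χ t R₀ = ψ t R₀) →
    (∀ t r, T ≤ t → R₀ ≤ r → |ψ t r| ≤ P) →
    (∀ ε > 0, ∃ u₀ : ℝ, ∀ t r, T ≤ t → R₀ ≤ r → u₀ ≤ t - r → |χ t r| ≤ ε) →
    ∀ ε > 0, ∃ u₀ : ℝ, ∀ t r, T ≤ t → R₀ ≤ r → u₀ ≤ t - r →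
      |ψ t r| ≤ ε ∧ |deriv (fun s ↦ ψ s r - χ s r) t| ≤ ε ∧ |deriv (fun s ↦ ψ t s - χ t s) r| ≤ ε

/-- **`NoParkingDecayBelow 1` is M2 verbatim.**  The right-hand side is, token for token, the body
of the line file's `def NoParkingDecay : Prop` (2026-08-16, skeleton 7cb29291…); the equivalence is
definitional (`Iff.rfl`). [folklore] -/
theorem noParkingDecayBelow_one_iff : NoParkingDecayBelow 1 ↔
  ∀ (T R₀ η P : ℝ) (ν : ℝ → ℝ) (V ψ χ : ℝ → ℝ → ℝ),
    0 ≤ R₀ → η < 1 →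
    ContinuousOn ν (Set.Ici R₀) →
    IntegrableOn (fun s ↦ (s - R₀) * ν s) (Set.Ioi R₀) →
    (∫ s in Set.Ioi R₀, (s - R₀) * ν s) ≤ η →
    (∀ t r, T ≤ t → R₀ ≤ r → |V t r| ≤ ν r) →
    ContDiff ℝ 2 (Function.uncurry ψ) → ContDiff ℝ 2 (Function.uncurry χ) →
    (∀ t r, T ≤ t → R₀ ≤ r →
      iteratedDeriv 2 (fun s ↦ ψ s r) t - iteratedDeriv 2 (ψ t) r + V t r * ψ t r = 0) →
    (∀ t r, T ≤ t → R₀ ≤ r → iteratedDeriv 2 (fun s ↦ χ s r) t - iteratedDeriv 2 (χ t) r = 0) →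
    (∀ r, R₀ ≤ r → χ T r = ψ T r ∧ deriv (fun s ↦ χ s r) T = deriv (fun s ↦ ψ s r) T) →
    (∀ t, T ≤ t → χ t R₀ = ψ t R₀) →
    (∀ t r, T ≤ t → R₀ ≤ r → |ψ t r| ≤ P) →
    (∀ ε > 0, ∃ u₀ : ℝ, ∀ t r, T ≤ t → R₀ ≤ r → u₀ ≤ t - r → |χ t r| ≤ ε) →
    ∀ ε > 0, ∃ u₀ : ℝ, ∀ t r, T ≤ t → R₀ ≤ r → u₀ ≤ t - r →
      |ψ t r| ≤ ε ∧ |deriv (fun s ↦ ψ s r - χ s r) t| ≤ ε ∧ |deriv (fun s ↦ ψ t s - χ t s) r| ≤ ε :=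
  Iff.rfl

/-- **`NoParkingDecayUpTo η₀`** — M2 with its Bargmann threshold `η < 1` replaced by `η ≤ η₀`
(every other token identical).  For `η₀ ≥ 1` this is a strengthening of M2
(`noParkingDecayBelow_one_of_noParkingDecayUpTo`); it is false at `η₀ = 2 log 2`
(`not_noParkingDecayUpTo_two_mul_log_two`).
[topic: Summits/FinalStateConjecture/FinalStateConjecture — crux NecksCertify, line bargmann-small-late-exterior, rung M2] -/
def NoParkingDecayUpTo (η₀ : ℝ) : Prop :=
  ∀ (T R₀ η P : ℝ) (ν : ℝ → ℝ) (V ψ χ : ℝ → ℝ → ℝ),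
    0 ≤ R₀ → η ≤ η₀ →
    ContinuousOn ν (Set.Ici R₀) →
    IntegrableOn (fun s ↦ (s - R₀) * ν s) (Set.Ioi R₀) →
    (∫ s in Set.Ioi R₀, (s - R₀) * ν s) ≤ η →
    (∀ t r, T ≤ t → R₀ ≤ r → |V t r| ≤ ν r) →
    ContDiff ℝ 2 (Function.uncurry ψ) → ContDiff ℝ 2 (Function.uncurry χ) →
    (∀ t r, T ≤ t → R₀ ≤ r →
      iteratedDeriv 2 (fun s ↦ ψ s r) t - iteratedDeriv 2 (ψ t) r + V t r * ψ t r = 0) →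
    (∀ t r, T ≤ t → R₀ ≤ r → iteratedDeriv 2 (fun s ↦ χ s r) t - iteratedDeriv 2 (χ t) r = 0) →
    (∀ r, R₀ ≤ r → χ T r = ψ T r ∧ deriv (fun s ↦ χ s r) T = deriv (fun s ↦ ψ s r) T) →
    (∀ t, T ≤ t → χ t R₀ = ψ t R₀) →
    (∀ t r, T ≤ t → R₀ ≤ r → |ψ t r| ≤ P) →
    (∀ ε > 0, ∃ u₀ : ℝ, ∀ t r, T ≤ t → R₀ ≤ r → u₀ ≤ t - r → |χ t r| ≤ ε) →
    ∀ ε > 0, ∃ u₀ : ℝ, ∀ t r, T ≤ t → R₀ ≤ r → u₀ ≤ t - r →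
      |ψ t r| ≤ ε ∧ |deriv (fun s ↦ ψ s r - χ s r) t| ≤ ε ∧ |deriv (fun s ↦ ψ t s - χ t s) r| ≤ ε

/-- For `η₀ ≥ 1`, `NoParkingDecayUpTo η₀` implies M2 (`NoParkingDecayBelow 1`): it is a genuine
strengthening (`η < 1 ≤ η₀`).  More generally `NoParkingDecayUpTo η₀ → NoParkingDecayBelow η₁`
whenever `η₁ ≤ η₀`. [folklore] -/
theorem noParkingDecayBelow_of_noParkingDecayUpTo {η₀ η₁ : ℝ} (h₀ : η₁ ≤ η₀)
    (h : NoParkingDecayUpTo η₀) : NoParkingDecayBelow η₁ :=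
  fun T R₀ η P ν V ψ χ hR hη ↦ h T R₀ η P ν V ψ χ hR (hη.le.trans h₀)

/-- In particular for M2 itself (`η₁ = 1`). [folklore] -/
theorem noParkingDecayBelow_one_of_noParkingDecayUpTo {η₀ : ℝ} (h₀ : 1 ≤ η₀)
    (h : NoParkingDecayUpTo η₀) : NoParkingDecayBelow 1 :=
  noParkingDecayBelow_of_noParkingDecayUpTo h₀ h

/-! ## §4 The strengthened rung is false -/

/-- **M2's Bargmann threshold cannot be relaxed to `2 log 2`.**  `NoParkingDecayUpTo (2 log 2)`
(M2 `NoParkingDecay` with `η < 1` replaced by `η ≤ 2 log 2`) is FALSE: the Pöschl–Teller well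
`V = −2 sech² r` on `{t ≥ 0, r ≥ 0}` has Bargmann norm exactly `2 log 2`, satisfies every other
hypothesis of the rung with the static zero-energy resonance `ψ = tanh r` (bounded by `1`,
vanishing on the cylinder `r = 0`) and the free field `χ = (tanh(r+t) + tanh(r−t))/2` (same slab
data at `t = 0`, same trace, decaying in the late retarded region), yet `ψ(t, 2) = tanh 2 > 1/2` at
every retarded time.  (Pöschl–Teller 1933; Bargmann 1952 for the role of `∫ r|V|`; the instance
is checked here from first principles.) [folklore] -/
theorem not_noParkingDecayUpTo_two_mul_log_two : ¬ NoParkingDecayUpTo (2 * Real.log 2) := by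
  intro h
  have hV : ∀ t r : ℝ, (0:ℝ) ≤ t → (0:ℝ) ≤ r →
      |(fun (_ r : ℝ) ↦ -2 / Real.cosh r ^ 2) t r| ≤ ptMajorant r := by
    intro t r _ _
    simp only [ptMajorant, abs_div, abs_neg, abs_two, abs_pow, abs_of_pos (Real.cosh_pos r)]
    exact le_rfl
  have hψ : ContDiff ℝ 2 (Function.uncurry fun (_ r : ℝ) ↦ th r) :=
    contDiff_th.comp contDiff_snd
  have hχ : ContDiff ℝ 2 (Function.uncurry fun (t r : ℝ) ↦ (th (r + t) + th (r - t)) / 2) :=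
    ((contDiff_th.comp (contDiff_snd.add contDiff_fst)).add
      (contDiff_th.comp (contDiff_snd.sub contDiff_fst))).div_const 2
  have hpde1 : ∀ t r : ℝ, (0:ℝ) ≤ t → (0:ℝ) ≤ r →
      iteratedDeriv 2 (fun s ↦ (fun (_ r : ℝ) ↦ th r) s r) t
        - iteratedDeriv 2 ((fun (_ r : ℝ) ↦ th r) t) r
        + (fun (_ r : ℝ) ↦ -2 / Real.cosh r ^ 2) t r * (fun (_ r : ℝ) ↦ th r) t r = 0 := by
    intro t r _ _
    simp only [iteratedDeriv_const]
    have e : (fun r : ℝ ↦ th r) = th := rfl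
    rw [e, iteratedDeriv_two_th, th₂_eq]
    simp
  have hpde2 : ∀ t r : ℝ, (0:ℝ) ≤ t → (0:ℝ) ≤ r →
      iteratedDeriv 2 (fun s ↦ (fun (t r : ℝ) ↦ (th (r + t) + th (r - t)) / 2) s r) t
        - iteratedDeriv 2 ((fun (t r : ℝ) ↦ (th (r + t) + th (r - t)) / 2) t) r = 0 := by
    intro t r _ _
    simp only []
    rw [iteratedDeriv_two_chi_t, iteratedDeriv_two_chi_r]
    ring
  have hdata : ∀ r : ℝ, (0:ℝ) ≤ r →
      (fun (t r : ℝ) ↦ (th (r + t) + th (r - t)) / 2) 0 r = (fun (_ r : ℝ) ↦ th r) 0 r ∧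
      deriv (fun s ↦ (fun (t r : ℝ) ↦ (th (r + t) + th (r - t)) / 2) s r) 0
        = deriv (fun s ↦ (fun (_ r : ℝ) ↦ th r) s r) 0 := by
    intro r _
    constructor
    · simp only [add_zero, sub_zero]; ring
    · simp only []
      rw [(hasDerivAt_chi_t r 0).deriv, deriv_const]
      simp
  have htrace : ∀ t : ℝ, (0:ℝ) ≤ t →
      (fun (t r : ℝ) ↦ (th (r + t) + th (r - t)) / 2) t 0 = (fun (_ r : ℝ) ↦ th r) t 0 := by
    intro t _
    simp only [zero_add, zero_sub, th_neg, th_zero]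
    ring
  have hbound : ∀ t r : ℝ, (0:ℝ) ≤ t → (0:ℝ) ≤ r → |(fun (_ r : ℝ) ↦ th r) t r| ≤ 1 :=
    fun t r _ _ ↦ abs_th_le_one r
  have key := h 0 0 (2 * Real.log 2) 1 ptMajorant (fun _ r ↦ -2 / Real.cosh r ^ 2) (fun _ r ↦ th r)
    (fun t r ↦ (th (r + t) + th (r - t)) / 2) le_rfl le_rfl continuous_ptMajorant.continuousOn
    integrableOn_bargmann integral_bargmann.le hV hψ hχ hpde1 hpde2 hdata htrace hbound chi_decay
  obtain ⟨u₀, hu⟩ := key (1 / 2) (by norm_num)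
  obtain ⟨h1, -, -⟩ := hu (max u₀ 0 + 2) 2 (by positivity) (by norm_num)
    (by have := le_max_left u₀ 0; linarith)
  have h2 := one_half_lt_th_two
  have h3 : |th 2| = th 2 := abs_of_pos (by linarith)
  simp only [h3] at h1
  linarith

end Summit.FinalStateConjecture.FinalStateConjecture.Theorems.NecksCertify.Negative

end
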